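import Summits.QuantumFields.YangMills.Theorems.UnitScaleTiltProp7CoverTwistedChart
import Summits.QuantumFields.YangMills.Theorems.UnitScaleTiltProp7DivRecoveryOfCover
import Summits.QuantumFields.YangMills.Theorems.UnitScaleTiltProp7QTwSScalarSectorRegPr
import Summits.QuantumFields.YangMills.Theorems.UnitScaleTiltProp7TransverseRowOfTubeRowRegPr
import Summits.QuantumFields.YangMills.Theorems.UnitScaleTiltProp7SymAvgGLBridge
import HarnessLib

/-!
# Route `UnitScaleTilt`, crux K1 «MinimiserStabilityRegPr» (stmt-QuantumFields-19200), EX row `hGF`, the (L6) LOD line — SMALL MEMBERS VIA THE COVER, ROW (c1)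
# (chair ★`ym-ust-19200-p1` g24 2026-08-30 03:25:11Z «LOCATE-SMALL-MEMBERS = {(c1), (c2), the 10-line transfer}»):
# **THE SYMMETRIC-FRAME AVERAGING OPERATOR OF RECORD `Q_k(U₀) = η • toL2B ∘ QTwS U₀ ∘ toL2⁻¹` IS NATURAL UNDER THE `L^{jc}`-FOLD COVER** —
# `frameTwS (F.cover jc) (W∘π) (A∘π) y′ = frameTwS F W A (π y′)` and `logChartTwS (F.cover jc) (W∘π) (A∘π) = (logChartTwS F W A) ∘ π` EXACTLY (every background, every `A`);
# on the printed-regular class (`10¹²L³ε₀ ≤ 1`, where the chart is differentiable at `0`, ✓`differentiableAt_logChartTwS_of_regPr`) the chain rule gives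
# `QTwS (F.cover jc) (W∘π) (A∘π) = (QTwS F W A) ∘ π`, hence **`Qk (F.cover jc) (W∘π) (X̃∘π) = η • toL2B′((QTwS F W X)∘π)`** and **`‖Qk (F.cover jc) (W∘π)(X̃∘π)‖² = (L^{jc})³·‖Qk F W X̃‖²`**

Cell `ym3-torus` (HUMAN RULING D-0037, YM ladder rung R3 — YM₃ on T³ is a rung, NOT d = 4, NOT infinite volume, NOT a mass gap, NOT Clay; YM gap NOT proved), width seat
`ym3-torus-px17` (gen 9).  THEOREMS ONLY (0 `def`, 0 `sorry`, default heartbeats); `--supports stmt-QuantumFields-19200 --as helper`; count-neutral.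

WHY (chair ★p1 g24 03:24:41Z (iii) + 03:25:11Z).  px10 g11's ✓-to-be `Prop7LODAssemblyMember.curvedTarget_member` proves the curved target
`γ‖A‖² ≤ re⟪A, Δ^η(U₀)A⟫ + ‖projR(covLapSite U₀)Q″(D*_{U₀}A)‖² + a·‖Qk U₀ A‖²` only for members whose torus has room for the cube family (`s < m + n`); a SMALL member
`(F, n, K)` is handled by pulling back to the cover `F.cover jc` (✓`CoverSites.T3Family.cover`, `jc` large), applying the large-member target there to `A∘π`, and reading every slot
as `(L^{jc})³ ×` the member's slot.  ✓`Prop7CoverHilbertPullback` gives that for `‖A‖²`, `re⟪A, Δ^η A⟫`, `‖D*A‖²`; ✓`Prop7CoverQkc` gives it for print's CORNER-comb slot `Qkc`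
(chart `logChartTw`, frames `wrec`); THIS FILE gives it for the slot of record of the LOD line, the SYMMETRIC-frame `Qk` of ✓`Prop7SectET3CurvedPropagators` (chart `logChartTwS`,
accumulated frames `frameAccU` of ✓`Prop7SymAvgTwSym`) — row (c1).  Row (c2) (the projector `projR (covLapSite ·) Q″` for the top nested mean of record) and the transfer are separate files.

HOW.  §1 (any `Params`, `M₂(ℂ)ˣ`-valued fields, standing range `k ≤ m + K`): the one-step EML average, its iterate, the twisted centre-stair transporters `tstairU`, the covariant
frame `vframeCovU = exp[mean log]`, the covariant double bar `dbarCovU`, its tower `dbarCovIterU` and the accumulated frames `frameAccU` all commute with the lift — induction on the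
level over ✓`SmallMembersCoverLift.holT_comp_projBond`, ✓`CoverSites.proj_emb`, ✓`Prop7CoverTwistedChart.avgFunGL_comp_projBond`∕`iterGL_comp_projBond` read through the bridge
✓`Prop7SymAvgGL.avgFunGL_eq_emlAvgU`∕`iterGL_eq_emlIterU`.  §2 (T³ letters): the comparison-site identification `siteShift` commutes with `proj` (the site half of
✓`SmallMembersCoverLift.fieldShift_comp_projBond`), so `frameTwS`, `dbarTwS`, `logChartTwS` are natural (with ✓`descendToGL_cover`).  §3: Mathlib's chain rule on §2's identity
`logChartTwS′ ∘ (·∘π) = (·∘π) ∘ logChartTwS` at `0`, both charts differentiable on `RegPr` (✓`regPr_cover_iff`), exactly as ✓`Prop7CoverQkc.QTw_cover`; then ✓`Qk_toL2` and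
✓`Prop7CoverQkc.norm_sq_toL2B_cover`.
HONEST SCOPE.  Naturality bookkeeping; nothing of (c2), the transfer, `hT` for small members, `hGF`, (3.49), EX `stub_existenceMinimalOrbit`, the crux or the summit is proved here.

References: T. Bałaban, CMP **98** (1985) 17–51 [Balaban1985Averaging] ((9) p.18, (58) p.27, (82) p.30, (87)–(92) p.31, (97) p.32, (127) p.36); CMP **99** (1985) 389–434
[Balaban1985BackgroundPropagators] ((3.13)–(3.16) p.393); CMP **102** (1985) 277–309 [Balaban1985Variational] ((44)–(45) p.285); CMP **109** (1987) 249–301 [Balaban1987RG1]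
((0.1)–(0.4), (0.11) pp.251–253).
-/

set_option autoImplicit false

noncomputable section

open scoped Matrix.Norms.L2Operator BigOperators

namespace Summit.QuantumFields.YangMills.Theorems.Prop7CoverTwistedChartSym

open NormedSpace
open Literature.MathematicalPhysics.QuantumFieldTheory.Balaban1983to89
open Literature.MathematicalPhysics.QuantumFieldTheory.Balaban1983to89.T3ContinuumYM3Torus
open T4Continuum BlockAveraging
open BlockAveraging (Idx)
open T3LevelShift (siteShift)
open T3PrintedRegularOrbits (sites_eq)
open T3PrintedRegularMinimiser (RegPr)
open T3SectALandauChart (bgUnits eta)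
open B10Eq27TorusAxialLog (holT)
open B7Prop1Explicit (expUnit)
open CoverSites
open Summit.QuantumFields.YangMills.Theorems.Prop8Chart (emlAvgU emlIterU emlIterU_succ)
open Summit.QuantumFields.YangMills.Theorems.Prop7SymAvgGL (descendToGL avgFunGL_eq_emlAvgU iterGL_eq_emlIterU)
open Summit.QuantumFields.YangMills.Theorems.Prop7SymAvgTwSym (tstairU vframeCovU dbarCovU dbarCovIterU frameAccU tstairU_def coe_vframeCovU dbarCovU_apply dbarCovIterU_succ
  frameAccU_succ frameTwS dbarTwS logChartTwS QTwS frameTwS_def dbarTwS_def logChartTwS_apply differentiableAt_logChartTwS_of_regPr)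
open Summit.QuantumFields.YangMills.Theorems.Prop7SectET3HilbertLetters (toL2 toL2B)
open Summit.QuantumFields.YangMills.Theorems.Prop7SectET3CurvedPropagators (Qk)
open Summit.QuantumFields.YangMills.Theorems.Prop7TransverseRowOfTubeRowRegPr (Qk_toL2)
open Summit.QuantumFields.YangMills.Theorems.SmallMembersCoverLift (holT_comp_projBond regPr_cover_iff)
open Summit.QuantumFields.YangMills.Theorems.Prop7CoverTwistedChart (avgFunGL_comp_projBond iterGL_comp_projBond descendToGL_cover dbar_congr)
open Summit.QuantumFields.YangMills.Theorems.Prop7CoverHilbertPullback (bgUnits_cover eta_cover)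
open Summit.QuantumFields.YangMills.Theorems.Prop7CoverQkc (norm_sq_toL2B_cover)

/-! ## §1 The symmetric covariant frames commute with the lift (any `Params`, `M₂(ℂ)ˣ`-valued fields, standing range) -/

section Tower

variable (P : Params) (jc : ℕ)

/-- The one-step EML (0.4) average of the lift is the lift of the average (`j + 1 ≤ m + K`). [cite: Balaban1987RG1, (0.4) p.253] -/
theorem emlAvgU_comp_projBond {j : ℕ} (hj : j + 1 ≤ P.m + P.K) (U : GaugeField P j (Matrix (Fin 2) (Fin 2) ℂ)ˣ) :
    emlAvgU (U ∘ projBond P jc j) = emlAvgU U ∘ projBond P jc (j + 1) := by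
  rw [← avgFunGL_eq_emlAvgU, ← avgFunGL_eq_emlAvgU]
  exact avgFunGL_comp_projBond P jc hj U

/-- The `k`-fold EML average of the lift is the lift of the `k`-fold average (`k ≤ m + K`). [cite: Balaban1987RG1, (0.11) p.253] -/
theorem emlIterU_comp_projBond (U : GaugeField P 0 (Matrix (Fin 2) (Fin 2) ℂ)ˣ) (k : ℕ) (hk : k ≤ P.m + P.K) :
    emlIterU k (U ∘ projBond P jc 0) = emlIterU k U ∘ projBond P jc k := by
  rw [← iterGL_eq_emlIterU, ← iterGL_eq_emlIterU]
  exact iterGL_comp_projBond P jc U k hk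

/-- The twisted centre-stair transporters (58) of the lifts are those at the projected coarse site. [cite: Balaban1985Averaging, (58) p.27, (9) p.18] -/
theorem tstairU_comp_proj {j : ℕ} (hj : j + 1 ≤ P.m + P.K) (U₀ W : GaugeField P j (Matrix (Fin 2) (Fin 2) ℂ)ˣ) (y : Site (cover P jc) (j + 1)) (i : Idx P) :
    tstairU (U₀ ∘ projBond P jc j) (W ∘ projBond P jc j) y i = tstairU U₀ W (proj P jc (j + 1) y) i := by
  rw [tstairU_def, tstairU_def, holT_comp_projBond, holT_comp_projBond, proj_emb P jc j hj]
  rfl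

/-- ★ **THE SYMMETRIC COVARIANT BLOCK FRAME (82) OF THE LIFTS IS THE FRAME AT THE PROJECTED SITE**: `w_sym(U₀∘π; W∘π)(y′) = w_sym(U₀; W)(π y′)`.
[cite: Balaban1985Averaging, (82) p.30; Balaban1987RG1, (0.1) p.251] -/
theorem vframeCovU_comp_proj {j : ℕ} (hj : j + 1 ≤ P.m + P.K) (U₀ W : GaugeField P j (Matrix (Fin 2) (Fin 2) ℂ)ˣ) (y : Site (cover P jc) (j + 1)) :
    vframeCovU (U₀ ∘ projBond P jc j) (W ∘ projBond P jc j) y = vframeCovU U₀ W (proj P jc (j + 1) y) := by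
  apply Units.ext
  rw [coe_vframeCovU, coe_vframeCovU]
  have hfun : (fun i : Idx (cover P jc) => ((tstairU (U₀ ∘ projBond P jc j) (W ∘ projBond P jc j) y i : (Matrix (Fin 2) (Fin 2) ℂ)ˣ) : Matrix (Fin 2) (Fin 2) ℂ))
      = fun i : Idx P => ((tstairU U₀ W (proj P jc (j + 1) y) i : (Matrix (Fin 2) (Fin 2) ℂ)ˣ) : Matrix (Fin 2) (Fin 2) ℂ) := by
    funext i
    rw [tstairU_comp_proj P jc hj]
  exact congrArg _ hfun

/-- ★ **THE COVARIANT DOUBLE BAR (89) OF THE LIFTS IS THE LIFT OF THE DOUBLE BAR.** [cite: Balaban1985Averaging, (89) p.31; Balaban1987RG1, (0.4) p.253] -/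
theorem dbarCovU_comp_projBond {j : ℕ} (hj : j + 1 ≤ P.m + P.K) (U₀ W : GaugeField P j (Matrix (Fin 2) (Fin 2) ℂ)ˣ) :
    dbarCovU (U₀ ∘ projBond P jc j) (W ∘ projBond P jc j) = dbarCovU U₀ W ∘ projBond P jc (j + 1) := by
  funext c
  rw [Function.comp_apply, dbarCovU_apply, dbarCovU_apply, emlAvgU_comp_projBond P jc hj, vframeCovU_comp_proj P jc hj, vframeCovU_comp_proj P jc hj,
    Function.comp_apply, projBond_src, projBond_tgt]

/-- ★ **THE COVARIANT DOUBLE-BAR TOWER (127) OF THE LIFTS IS THE LIFT OF THE TOWER** (`k ≤ m + K`). [cite: Balaban1985Averaging, (127) p.36; Balaban1987RG1, (0.11) p.253] -/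
theorem dbarCovIterU_comp_projBond (U₀ W : GaugeField P 0 (Matrix (Fin 2) (Fin 2) ℂ)ˣ) :
    ∀ k : ℕ, k ≤ P.m + P.K → dbarCovIterU k (U₀ ∘ projBond P jc 0) (W ∘ projBond P jc 0) = dbarCovIterU k U₀ W ∘ projBond P jc k
  | 0, _ => rfl
  | k + 1, hk => by
    rw [dbarCovIterU_succ, dbarCovIterU_succ, dbarCovIterU_comp_projBond U₀ W k (by omega), emlIterU_comp_projBond P jc U₀ k (by omega)]
    exact dbarCovU_comp_projBond P jc hk _ _

/-- ★★ **THE ACCUMULATED SYMMETRIC FRAMES (97) OF THE LIFTS ARE THE FRAMES AT THE PROJECTED SITE**: `v_k(U₀∘π; W∘π)(y′) = v_k(U₀; W)(π y′)` (`k ≤ m + K`).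
[cite: Balaban1985Averaging, (97) p.32, (87) p.31; Balaban1987RG1, (0.1) p.251] -/
theorem frameAccU_comp_proj (U₀ W : GaugeField P 0 (Matrix (Fin 2) (Fin 2) ℂ)ˣ) :
    ∀ k : ℕ, k ≤ P.m + P.K → ∀ y : Site (cover P jc) k, frameAccU k (U₀ ∘ projBond P jc 0) (W ∘ projBond P jc 0) y = frameAccU k U₀ W (proj P jc k y)
  | 0, _, _ => rfl
  | k + 1, hk, y => by
    rw [frameAccU_succ, frameAccU_succ, frameAccU_comp_proj U₀ W k (by omega) (emb y), proj_emb P jc k hk,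
      emlIterU_comp_projBond P jc U₀ k (by omega), dbarCovIterU_comp_projBond P jc U₀ W k (by omega), vframeCovU_comp_proj P jc hk]

end Tower

/-! ## §2 The T³ letters: `frameTwS`, `dbarTwS`, `logChartTwS` are natural under the cover (EXACT, every background, every `A`) -/

variable (F : T3Family) (jc : ℕ) {n K : ℕ} (h : n ≤ K)

/-- The comparison-site identification commutes with the covering projections (the site half of ✓`SmallMembersCoverLift.fieldShift_comp_projBond`: both are `ZMod.val`-reducing on the same
representatives, and the two moduli agree). [cite: Balaban1987RG1, (0.1) p.251] -/
theorem proj_siteShift (y : Site ((F.cover jc).P n) 0) :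
    proj (F.P K) jc (K - n) (siteShift (sites_eq (F.cover jc) n K h) y) = siteShift (sites_eq F n K h) (proj (F.P n) jc 0 y) := by
  funext ν
  apply ZMod.val_injective
  have e1 : (proj (F.P K) jc (K - n) (siteShift (sites_eq (F.cover jc) n K h) y) ν).val = (y ν).val % (F.P K).sitesPerDir (K - n) := by
    rw [val_proj]
    exact congrArg (fun v : ℕ => v % (F.P K).sitesPerDir (K - n)) (T3LevelShift.coordEquiv_val (sites_eq (F.cover jc) n K h) (y ν))
  have e2 : (siteShift (sites_eq F n K h) (proj (F.P n) jc 0 y) ν).val = (y ν).val % (F.P n).sitesPerDir 0 :=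
    (T3LevelShift.coordEquiv_val (sites_eq F n K h) (proj (F.P n) jc 0 y ν)).trans (val_proj (F.P n) jc 0 y ν)
  exact e1.trans ((congrArg (fun N : ℕ => (y ν).val % N) (sites_eq F n K h).symm).trans e2.symm)

/-- ★★ **THE ACCUMULATED SYMMETRIC FRAME OF THE LIFT IS THE LIFT OF THE FRAME**: `frameTwS (F.cover jc) (W∘π) (A∘π) y′ = frameTwS F W A (π y′)`.
[cite: Balaban1985Averaging, (97) p.32, (82) p.30; Balaban1987RG1, (0.1) p.251] -/
theorem frameTwS_cover (W : GaugeField (F.P K) 0 (Matrix.specialUnitaryGroup (Fin 2) ℂ)) (A : PBond (F.P K) 0 → Matrix (Fin 2) (Fin 2) ℂ) (y : Site ((F.cover jc).P n) 0) :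
    frameTwS (F.cover jc) n K h (W ∘ projBond (F.P K) jc 0) (A ∘ projBond (F.P K) jc 0) y = frameTwS F n K h W A (proj (F.P n) jc 0 y) := by
  rw [frameTwS_def, frameTwS_def, bgUnits_cover]
  have hk : K - n ≤ (F.P K).m + (F.P K).K := by show K - n ≤ F.m + K; omega
  -- the lifted perturbation is the lift of the perturbation (definitionally), so §1 applies; then move `proj` through `siteShift`
  have key := frameAccU_comp_proj (F.P K) jc (bgUnits F K W) (fun b : PBond (F.P K) 0 => expUnit (A b) * bgUnits F K W b) (K - n) hk
    (siteShift (sites_eq (F.cover jc) n K h) y)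
  rw [proj_siteShift F jc h] at key
  exact key

/-- ★★ **THE RE-BASED TWISTED DOUBLE BAR OF THE LIFT IS THE LIFT OF THE DOUBLE BAR**: `dbarTwS (F.cover jc) (W∘π) (A∘π) c′ = dbarTwS F W A (π c′)`.
[cite: Balaban1985Averaging, (89)–(92) p.31; Balaban1987RG1, (0.1) p.251] -/
theorem dbarTwS_cover (W : GaugeField (F.P K) 0 (Matrix.specialUnitaryGroup (Fin 2) ℂ)) (A : PBond (F.P K) 0 → Matrix (Fin 2) (Fin 2) ℂ) (c : PBond ((F.cover jc).P n) 0) :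
    dbarTwS (F.cover jc) n K h (W ∘ projBond (F.P K) jc 0) (A ∘ projBond (F.P K) jc 0) c = dbarTwS F n K h W A (projBond (F.P n) jc 0 c) := by
  rw [dbarTwS_def, dbarTwS_def, frameTwS_cover F jc h, frameTwS_cover F jc h]
  have h1 : descendToGL (F.cover jc) n K h (fun b => expUnit ((A ∘ projBond (F.P K) jc 0) b) * bgUnits (F.cover jc) K (W ∘ projBond (F.P K) jc 0) b) c
      = descendToGL F n K h (fun b => expUnit (A b) * bgUnits F K W b) (projBond (F.P n) jc 0 c) :=
    congrFun (descendToGL_cover F jc h (fun b => expUnit (A b) * bgUnits F K W b)) c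
  have h2 : descendToGL (F.cover jc) n K h (bgUnits (F.cover jc) K (W ∘ projBond (F.P K) jc 0)) c = descendToGL F n K h (bgUnits F K W) (projBond (F.P n) jc 0 c) :=
    congrFun (descendToGL_cover F jc h (bgUnits F K W)) c
  have h3 : frameTwS F n K h W A (proj (F.P n) jc 0 c.tgt) = frameTwS F n K h W A (projBond (F.P n) jc 0 c).tgt :=
    congrArg _ (projBond_tgt (F.P n) jc 0 c).symm
  exact dbar_congr rfl h1 h3 h2

/-- ★★★ **`logChartTwS (F.cover jc) (W∘π) (A∘π) = (logChartTwS F W A) ∘ π`** — the re-based twisted log-chart of record is natural under the cover, as a FUNCTION of `A`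
(no regularity, no derivative). [cite: Balaban1985RegularSpaces, (1.31) p.82; Balaban1985BackgroundPropagators, (3.13)-(3.14) p.393; Balaban1987RG1, (0.1) p.251] -/
theorem logChartTwS_cover (W : GaugeField (F.P K) 0 (Matrix.specialUnitaryGroup (Fin 2) ℂ)) (A : PBond (F.P K) 0 → Matrix (Fin 2) (Fin 2) ℂ) :
    logChartTwS (F.cover jc) n K h (W ∘ projBond (F.P K) jc 0) (A ∘ projBond (F.P K) jc 0) = logChartTwS F n K h W A ∘ projBond (F.P n) jc 0 := by
  funext c
  rw [logChartTwS_apply, Function.comp_apply, logChartTwS_apply, dbarTwS_cover F jc h]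

/-! ## §3 The chain rule on `RegPr`: `QTwS`, `Qk` and the degree identity of the averaging slot of record — row (c1) -/

/-- ★★★ **THE SYMMETRIC-FRAME AVERAGING OPERATOR OF THE LIFT IS THE LIFT OF THE OPERATOR** at a printed-regular background (`0 < ε₀`, `10¹²L³ε₀ ≤ 1`):
`QTwS (F.cover jc) (W∘π) (A∘π) = (QTwS F W A) ∘ π` — the Fréchet derivative at `0` of §2's identity, both charts being differentiable at `0` on `RegPr` (✓`regPr_cover_iff`).
[cite: Balaban1985BackgroundPropagators, (3.14)-(3.15) p.393; Balaban1985Variational, (44) p.285; Balaban1987RG1, (0.1) p.251] -/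
theorem QTwS_cover {ε₀ : ℝ} (hε₀ : 0 < ε₀) (hWε : 10 ^ 12 * (F.L : ℝ) ^ 3 * ε₀ ≤ 1)
    (W : GaugeField (F.P K) 0 (Matrix.specialUnitaryGroup (Fin 2) ℂ)) (hreg : RegPr F n K ε₀ W) (A : PBond (F.P K) 0 → Matrix (Fin 2) (Fin 2) ℂ) :
    QTwS (F.cover jc) n K h (W ∘ projBond (F.P K) jc 0) (A ∘ projBond (F.P K) jc 0) = QTwS F n K h W A ∘ projBond (F.P n) jc 0 := by
  -- the two pullbacks as continuous linear maps
  let Pf : (PBond (F.P K) 0 → Matrix (Fin 2) (Fin 2) ℂ) →L[ℂ] (PBond ((F.cover jc).P K) 0 → Matrix (Fin 2) (Fin 2) ℂ) :=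
    LinearMap.toContinuousLinearMap (LinearMap.funLeft ℂ (Matrix (Fin 2) (Fin 2) ℂ) (projBond (F.P K) jc 0))
  let Pc : (PBond (F.P n) 0 → Matrix (Fin 2) (Fin 2) ℂ) →L[ℂ] (PBond ((F.cover jc).P n) 0 → Matrix (Fin 2) (Fin 2) ℂ) :=
    LinearMap.toContinuousLinearMap (LinearMap.funLeft ℂ (Matrix (Fin 2) (Fin 2) ℂ) (projBond (F.P n) jc 0))
  have hPf : ∀ B, Pf B = B ∘ projBond (F.P K) jc 0 := fun B => rfl
  have hPc : ∀ C, Pc C = C ∘ projBond (F.P n) jc 0 := fun C => rfl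
  -- §2: the charts agree as functions
  have hfun : (logChartTwS (F.cover jc) n K h (W ∘ projBond (F.P K) jc 0)) ∘ Pf = Pc ∘ logChartTwS F n K h W := by
    funext B
    rw [Function.comp_apply, Function.comp_apply, hPf, hPc]
    exact logChartTwS_cover F jc h W B
  -- differentiability at `0` of both charts (printed-regular class; the cover's `L` is the member's)
  have hdF : DifferentiableAt ℂ (logChartTwS F n K h W) 0 := differentiableAt_logChartTwS_of_regPr F h hε₀ hWε W hreg
  have hreg' : RegPr (F.cover jc) n K ε₀ (W ∘ projBond (F.P K) jc 0) := (regPr_cover_iff jc F ε₀ W).2 hreg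
  have hWε' : 10 ^ 12 * ((F.cover jc).L : ℝ) ^ 3 * ε₀ ≤ 1 := hWε
  have hdC : DifferentiableAt ℂ (logChartTwS (F.cover jc) n K h (W ∘ projBond (F.P K) jc 0)) (Pf 0) := by
    rw [map_zero]
    exact differentiableAt_logChartTwS_of_regPr (F.cover jc) h hε₀ hWε' (W ∘ projBond (F.P K) jc 0) hreg'
  -- chain rule on both sides of `hfun`
  have hL : fderiv ℂ ((logChartTwS (F.cover jc) n K h (W ∘ projBond (F.P K) jc 0)) ∘ Pf) 0
      = (fderiv ℂ (logChartTwS (F.cover jc) n K h (W ∘ projBond (F.P K) jc 0)) 0).comp Pf := by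
    rw [fderiv_comp 0 hdC Pf.differentiableAt, Pf.fderiv, map_zero]
  have hR : fderiv ℂ (Pc ∘ logChartTwS F n K h W) 0 = Pc.comp (fderiv ℂ (logChartTwS F n K h W) 0) := by
    rw [fderiv_comp 0 (by exact Pc.differentiableAt) hdF, Pc.fderiv]
  have key : (fderiv ℂ (logChartTwS (F.cover jc) n K h (W ∘ projBond (F.P K) jc 0)) 0).comp Pf = Pc.comp (fderiv ℂ (logChartTwS F n K h W) 0) := by
    rw [← hL, ← hR, hfun]
  have := congrArg (fun T : (PBond (F.P K) 0 → Matrix (Fin 2) (Fin 2) ℂ) →L[ℂ] (PBond ((F.cover jc).P n) 0 → Matrix (Fin 2) (Fin 2) ℂ) => T A) key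
  simp only [ContinuousLinearMap.comp_apply, hPf, hPc] at this
  exact this

variable {c₀ cB : ℝ} [Fact (0 < c₀)] [Fact (0 < cB)]

omit [Fact (0 < c₀)] [Fact (0 < cB)] in
/-- ★★★ **ROW (c1) — THE AVERAGING SLOT OF RECORD OF THE LIFT**: `Qk (F.cover jc) (W∘π) (X̃∘π) = η • toL2B′ ((QTwS F W X) ∘ π)` on `RegPr` (`η(F.cover jc) = η(F)`).
[cite: Balaban1985BackgroundPropagators, (3.14)-(3.15) p.393; Balaban1985Variational, (44)-(45) p.285; Balaban1987RG1, (0.1) p.251] -/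
theorem Qk_cover {ε₀ : ℝ} (hε₀ : 0 < ε₀) (hWε : 10 ^ 12 * (F.L : ℝ) ^ 3 * ε₀ ≤ 1)
    (W : GaugeField (F.P K) 0 (Matrix.specialUnitaryGroup (Fin 2) ℂ)) (hreg : RegPr F n K ε₀ W) (X : PBond (F.P K) 0 → Matrix (Fin 2) (Fin 2) ℂ) :
    Qk (F.cover jc) n K h c₀ cB (W ∘ projBond (F.P K) jc 0) (toL2 (F.cover jc) K c₀ (X ∘ projBond (F.P K) jc 0))
      = (((eta F n K : ℝ) : ℂ)) • toL2B (F.cover jc) n cB (QTwS F n K h W X ∘ projBond (F.P n) jc 0) := by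
  rw [Qk_toL2, QTwS_cover F jc h hε₀ hWε W hreg X]
  rfl

omit [Fact (0 < c₀)] in
/-- ★★★ **ROW (c1) — THE AVERAGING SLOT SCALES BY THE DEGREE**: `‖Qk (F.cover jc) (W∘π) (X̃∘π)‖² = (L^{jc})³·‖Qk F W X̃‖²` (`0 < ε₀`, `10¹²L³ε₀ ≤ 1`, `W ∈ RegPr F n K ε₀`).
[cite: Balaban1985BackgroundPropagators, (3.14)-(3.16) p.393; Balaban1987RG1, (0.2) p.252] -/
theorem norm_sq_Qk_cover {ε₀ : ℝ} (hε₀ : 0 < ε₀) (hWε : 10 ^ 12 * (F.L : ℝ) ^ 3 * ε₀ ≤ 1)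
    (W : GaugeField (F.P K) 0 (Matrix.specialUnitaryGroup (Fin 2) ℂ)) (hreg : RegPr F n K ε₀ W) (X : PBond (F.P K) 0 → Matrix (Fin 2) (Fin 2) ℂ) :
    ‖Qk (F.cover jc) n K h c₀ cB (W ∘ projBond (F.P K) jc 0) (toL2 (F.cover jc) K c₀ (X ∘ projBond (F.P K) jc 0))‖ ^ 2
      = ((F.L : ℝ) ^ jc) ^ 3 * ‖Qk F n K h c₀ cB W (toL2 F K c₀ X)‖ ^ 2 := by
  rw [Qk_cover F jc h hε₀ hWε W hreg X, Qk_toL2, norm_smul, norm_smul, mul_pow, mul_pow, norm_sq_toL2B_cover]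
  ring

omit [Fact (0 < c₀)] in
/-- ★★ **THE WEIGHTED AVERAGING SLOT OF THE CURVED TARGET SCALES BY THE DEGREE**: with the LOD line's coefficient `a = a₀·(c₀∕cB)·(L^{K−n})³` (the same number for the member and
its cover, `(F.cover jc).L = F.L`), `a·‖Qk (F.cover jc) (W∘π)(X̃∘π)‖² = (L^{jc})³·(a·‖Qk F W X̃‖²)` — the third slot of ✓`Prop7LODAssembly.curvedTarget_of_LOD_topMean`'s target, ready for
the transfer. [cite: Balaban1985BackgroundPropagators, (3.16) p.393; Balaban1987RG1, (0.2) p.252] -/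
theorem mul_norm_sq_Qk_cover {ε₀ : ℝ} (hε₀ : 0 < ε₀) (hWε : 10 ^ 12 * (F.L : ℝ) ^ 3 * ε₀ ≤ 1) (a₀ : ℝ)
    (W : GaugeField (F.P K) 0 (Matrix.specialUnitaryGroup (Fin 2) ℂ)) (hreg : RegPr F n K ε₀ W) (X : PBond (F.P K) 0 → Matrix (Fin 2) (Fin 2) ℂ) :
    (a₀ * (c₀ / cB) * (((F.cover jc).L : ℝ) ^ (K - n)) ^ 3)
        * ‖Qk (F.cover jc) n K h c₀ cB (W ∘ projBond (F.P K) jc 0) (toL2 (F.cover jc) K c₀ (X ∘ projBond (F.P K) jc 0))‖ ^ 2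
      = ((F.L : ℝ) ^ jc) ^ 3 * ((a₀ * (c₀ / cB) * ((F.L : ℝ) ^ (K - n)) ^ 3) * ‖Qk F n K h c₀ cB W (toL2 F K c₀ X)‖ ^ 2) := by
  rw [norm_sq_Qk_cover F jc h hε₀ hWε W hreg X, T3Family.cover_L]
  ring

end Summit.QuantumFields.YangMills.Theorems.Prop7CoverTwistedChartSym

end
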